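import Mathlib

/-!
# SkeletonJ1R — crux idea `flat-multiplier-coercive-datum` (crux-ideate r1 k1 g2): first lemmas

The lever: at an exactly tangent, near-straight, constant-core skeleton with FREE tails, the Γ-large part
`K = Ω m(μD) J` of the in-ball linearised normal operator `L₁ = w∂_τ − K − S⊥ − C` is an exact flat
(translation-invariant) Fourier multiplier composed with the rotation `J`, hence SKEW in flat `L²(dτ)` and
commuting with every other flat multiplier.  Pairing `(L₁ + 3/2)ψ` (clamped `ψ`) against `ψ + θ P Π_low ψ`
with `P = −f(Ω m(μD)) J` (capped, flat) gives a Γ-uniform lower bound `‖(L₁+3/2)ψ‖ ≥ c‖ψ‖` — hence, by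
duality, a Γ-uniform free `L²` right inverse — under ONE Γ-free pointwise datum condition: the half eigen-gap
`a(τ)` of the symmetric normal strain stays `< 3/4` (trace identity `tr S⊥ = 3/2 − w′` ⇒ pointwise spectrum
`3/4 ± a`).  The GP straight datum violates it (`a = 0.89` at the waist, `8.4` at closest approach); the
ORTHOGONAL HORIZONTAL SKEW PAIR satisfies it with `sup a = (1+δ)/2`.

Below: (1) the abstract energy/multiplier coercivity shapes (proved — they are the whole functional-analytic
content; everything Γ-dependent sits in verifying their hypotheses with flat symbols), (2) the 2×2 trace-identity
margin and the orthogonal-pair stretching maximum as `Prop`s (targets for `norm_num`/`nlinarith` provers).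
-/

namespace Summit.NavierStokesRegularity.NavierStokesRegularity.Cruxes.SkeletonJ1R.FlatMultiplierCoercivity

open scoped InnerProductSpace

/-- ONE-TERM FLAT ENERGY COERCIVITY (the mass identity): on a real inner-product space, if `K` is skew on the
test class `D` and the remaining part `B` has quadratic form `≥ c‖x‖²` on `D`, then `‖(K + B) x‖ ≥ c ‖x‖` on `D`.
Instantiation: `H = L²(ball; ℝ²)^N` (γ-weighted), `D` = clamped `C¹` fields, `K = −Ω m(μD)J` (all Kelvin bands at
once), `B = w∂_τ − S⊥ − C + 3/2` whose form is `∫ (3/2 − ½w′ − sym S⊥)|ψ|² + cross`. -/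
def FlatEnergyCoercivity : Prop :=
  ∀ (H : Type) [NormedAddCommGroup H] [InnerProductSpace ℝ H] (D : Submodule ℝ H) (K B : D →ₗ[ℝ] H) (c : ℝ),
    (∀ x : D, inner ℝ (K x) (x : H) = 0) → (∀ x : D, c * ‖(x : H)‖ ^ 2 ≤ inner ℝ (B x) (x : H)) →
      ∀ x : D, c * ‖(x : H)‖ ≤ ‖K x + B x‖

theorem flatEnergyCoercivity_holds : FlatEnergyCoercivity := by
  intro H _ _ D K B c hK hB x
  have h1 : c * ‖(x : H)‖ ^ 2 ≤ inner ℝ (K x + B x) (x : H) := by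
    rw [inner_add_left, hK x, zero_add]; exact hB x
  have h2 : inner ℝ (K x + B x) (x : H) ≤ ‖K x + B x‖ * ‖(x : H)‖ := real_inner_le_norm _ _
  by_cases hx : ‖(x : H)‖ = 0
  · rw [hx, mul_zero]; exact norm_nonneg _
  · have hpos : 0 < ‖(x : H)‖ := lt_of_le_of_ne (norm_nonneg _) (Ne.symm hx)
    nlinarith [h1, h2, hpos]

/-- TWO-MULTIPLIER (GÅRDING-SHAPE) COERCIVITY: if a bounded test operator `M` (the flat multiplier
`θ P Π_low`, `‖M‖ ≤ ϑ`) makes the paired form `⟪A x, x + M x⟫ ≥ c‖x‖²` on `D`, then `‖A x‖ ≥ c/(1+ϑ) ‖x‖` on `D`.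
Instantiation: `A = L₁ + 3/2` (or its flat adjoint, or `−L₁` for clause 13), `M = θ P Π_low` with
`P = ∓ f(Ω m(μD)) J`, `f(x) = sign x · min(|x|, Λ_b)`, `Λ_b = γ/(8πRb²)`, `θΛ_b = ϑ`. -/
def TwoMultiplierCoercivity : Prop :=
  ∀ (H : Type) [NormedAddCommGroup H] [InnerProductSpace ℝ H] (D : Submodule ℝ H) (A : D →ₗ[ℝ] H)
    (M : H →L[ℝ] H) (c ϑ : ℝ), 0 ≤ ϑ → ‖M‖ ≤ ϑ →
    (∀ x : D, c * ‖(x : H)‖ ^ 2 ≤ inner ℝ (A x) ((x : H) + M (x : H))) →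
      ∀ x : D, c / (1 + ϑ) * ‖(x : H)‖ ≤ ‖A x‖

theorem twoMultiplierCoercivity_holds : TwoMultiplierCoercivity := by
  intro H _ _ D A M c ϑ hϑ hM hE x
  have h1 := hE x
  have h2 : inner ℝ (A x) ((x : H) + M (x : H)) ≤ ‖A x‖ * ‖(x : H) + M (x : H)‖ := real_inner_le_norm _ _
  have h3 : ‖(x : H) + M (x : H)‖ ≤ (1 + ϑ) * ‖(x : H)‖ := by
    calc ‖(x : H) + M (x : H)‖ ≤ ‖(x : H)‖ + ‖M (x : H)‖ := norm_add_le _ _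
      _ ≤ ‖(x : H)‖ + ‖M‖ * ‖(x : H)‖ := by gcongr; exact M.le_opNorm _
      _ ≤ ‖(x : H)‖ + ϑ * ‖(x : H)‖ := by gcongr
      _ = (1 + ϑ) * ‖(x : H)‖ := by ring
  have h1ϑ : 0 < 1 + ϑ := by linarith
  by_cases hx : ‖(x : H)‖ = 0
  · rw [hx, mul_zero]; exact norm_nonneg _
  · have hpos : 0 < ‖(x : H)‖ := lt_of_le_of_ne (norm_nonneg _) (Ne.symm hx)
    have h4 : c * ‖(x : H)‖ ^ 2 ≤ ‖A x‖ * ((1 + ϑ) * ‖(x : H)‖) := by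
      calc c * ‖(x : H)‖ ^ 2 ≤ ‖A x‖ * ‖(x : H) + M (x : H)‖ := h1.trans h2
        _ ≤ ‖A x‖ * ((1 + ϑ) * ‖(x : H)‖) := by gcongr
    have h5 : c * ‖(x : H)‖ ≤ ‖A x‖ * (1 + ϑ) := by nlinarith [h4, hpos]
    rw [div_mul_eq_mul_div, div_le_iff₀ h1ϑ]
    linarith [h5]

/-- TRACE-IDENTITY MARGIN (pointwise 2×2): with `w′ = 3/2 − tr S⊥` (incompressibility + zero axial vorticity
stretching balance at a tangent skeleton, `normalBlock` trace identity of the route), the symmetric part of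
`½ w′ I + S⊥` has spectrum `3/4 ± a`, `a² = ((p−r)/2)² + q²` the squared half eigen-gap of `sym S⊥ = [[p,q],[q,r]]`.
Hence the high-piece margin of the flat energy form is `3/4 − sup_τ a(τ)`. -/
def AnisotropyMarginBound : Prop :=
  ∀ p q r x y : ℝ, x ^ 2 + y ^ 2 = 1 →
    (1 / 2) * (3 / 2 - (p + r)) + (p * x ^ 2 + 2 * q * x * y + r * y ^ 2)
      ≤ 3 / 4 + Real.sqrt (((p - r) / 2) ^ 2 + q ^ 2)

/-- ORTHOGONAL SKEW PAIR: the axial stretching that a straight line vortex of reduced strength `ŝ = γ/(2π d₀²)`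
induces on an orthogonal skew line at distance `d₀` is `e(τ) = 2ŝ τ/(1+τ²)²` (τ in units of `d₀` from the
common perpendicular); its maximum is `(3√3/8) ŝ = 0.6495 ŝ` at `τ = 1/√3`, and the normal anisotropy there is
`a = e/2` (single orthogonal partner ⇒ normal block `diag(0, −e)`), so `w′(c) = 3/2 + δ` forces
`sup a = (1+δ)/2 < 3/4` iff `δ < 1/2`. -/
def OrthPairStretchMax : Prop :=
  ∀ τ : ℝ, 2 * τ / (1 + τ ^ 2) ^ 2 ≤ 3 * Real.sqrt 3 / 8

theorem orthPairStretchMax_holds : OrthPairStretchMax := by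
  intro τ
  have h1 : 0 < (1 + τ ^ 2) ^ 2 := by positivity
  rw [div_le_div_iff₀ h1 (by norm_num : (0:ℝ) < 8)]
  have hs : Real.sqrt 3 ^ 2 = 3 := Real.sq_sqrt (by norm_num)
  have hs0 : 0 < Real.sqrt 3 := Real.sqrt_pos.mpr (by norm_num)
  -- 16 τ ≤ 3√3 (1+τ²)² ; worst case τ = 1/√3
  nlinarith [sq_nonneg (τ * Real.sqrt 3 - 1), sq_nonneg (τ ^ 2 - 1 / 3), sq_nonneg τ,
    mul_pos hs0 h1, sq_nonneg (τ * Real.sqrt 3 - 1), mul_nonneg (sq_nonneg (τ * Real.sqrt 3 - 1)) (sq_nonneg τ),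
    mul_nonneg (sq_nonneg (τ * Real.sqrt 3 - 1)) hs0.le,
    mul_nonneg (mul_nonneg (sq_nonneg (τ * Real.sqrt 3 - 1)) hs0.le) (sq_nonneg τ)]

/-- FIRST LEMMA OF THE LINE (informal target, typed at the abstract level above): at every straight skew datum
whose pointwise normal-strain anisotropy satisfies `sup_τ a_j(τ) ≤ 3/4 − c₀` on the doubled balls, for
`Rb ≤ Rb₁(c₀, γ)` and `Γ ≥ Γ₂`, the in-ball linearised normal operator `L₁` of the exactly tangent near-straight
constant-core skeleton (free tails) satisfies, for all clamped `ψ`,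
`‖(L₁ + 3/2)ψ‖_{L²} ≥ (c₀/4)‖ψ‖_{L²}` and `‖L₁ ψ‖_{L²} ≥ (c₀/4)‖ψ‖_{L²}`, uniformly in Γ; consequently `L₁`
(free) has an `L²` right inverse of norm `≤ 4/c₀` (flat duality `L₁† ≅ −(L₁ + 3/2)`). -/
def FirstLemmaInformal : Prop := FlatEnergyCoercivity ∧ TwoMultiplierCoercivity

theorem firstLemmaInformal_holds : FirstLemmaInformal :=
  ⟨flatEnergyCoercivity_holds, twoMultiplierCoercivity_holds⟩

end Summit.NavierStokesRegularity.NavierStokesRegularity.Cruxes.SkeletonJ1R.FlatMultiplierCoercivity
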